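import Literature.NumberTheory.EllipticCurves.SilvermanHeightLogDiscriminant
import Literature.NumberTheory.EllipticCurves.Isogeny
import Literature.NumberTheory.DiophantineGeometry.Conductor
import Literature.NumberTheory.DiophantineGeometry.LocalReduction
import Mathlib.Data.Nat.Totient
import Mathlib.Analysis.Complex.ExponentialBounds
import HarnessLib

/-!
# Pasten 2024: the Faltings height of an elliptic curve over `ℚ` is `O(φ(N) log N)`
# (Thm 1.9), and changes by at most `½ log 163` within a `ℚ`-isogeny class — Néron-lattice form

Topic `Literature/NumberTheory/EllipticCurves`; TWO named facts (results in print, `def … : Prop`,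
D-0014) requested by `wi-09538` for route `ABC/IsogenyGlueCongruence` (crux-`A` glue `K1`, support
`PolyFreyMazurPairs` in conductor form), in the Néron-lattice rendering of the Faltings height of
`SilvermanHeightLogDiscriminant.lean`: `h(E/ℚ) = neronLatticeHeight L = −½ log covol(L.lattice)`
for a period pair `L` spanning the Néron lattice of a GLOBAL MINIMAL model `W`
(`IsNeronLatticeOf (W.baseChange ℂ) L`; Silverman 1986 (14) / Pasten 2024 §3:
`h(E) = −½ log((i/2)∫_{E(ℂ)} ω_E ∧ ω̄_E)`, `ω_E` a global Néron differential).

H. Pasten, *Shimura curves and the abc conjecture*, J. Number Theory 254 (2024) 214–335 =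
arXiv:1705.09251 (held; read §1 pp. 6–7, §3 p. 13, §6 Lemma 6.8):

* **Theorem 1.9** (p. 7; cf. Cor. 16.3): "Let `S` be a finite set of primes and let `P` be the
  product of the elements of `S`. For `ε > 0` and `N ≫_{ε,S} 1` (with an effective implicit
  constant), if `E` is an elliptic curve over `ℚ` semi-stable away from `S`, then we have
  `h(E) < (P/φ(P)) (ε + 1/48) φ(N) log N` (unconditional) [and `(P/φ(P))(ε + 1/24) φ(N) log log N`
  under GRH]. If `S = ∅` then the factor `P/φ(P)` is `1`." Here `N = N_E` is the conductor and
  `φ` Euler's function. Vendored: the unconditional bound (`pasten2024_height_lt`), with the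
  `S = ∅` case and the cruder `(1/48 + ε) N log N` (p. 7, display) PROVED from it. The GRH branch
  and the earlier `h(E) < (1/16 + ε) N log N` / `h(E) ≪ N log N` of Murty–Pasten 2013 (with
  von Känel–Matschke) are NOT vendored (Murty–Pasten 2013 is paywalled and unread here,
  acquisition requested; its bound is weaker than Thm 1.9 on semistable curves).
* **§3, p. 13**: "The degree of a minimal isogeny between `A_{1,N}` and `E` is uniformly bounded by
  `163` thanks to Mazur and Kenku, so Lemma 5 in [Faltings] gives `|h(A_{1,N}) − h(E)| ≤ ½ log 163
  < 3`"; the same argument for an arbitrary pair of `ℚ`-isogenous elliptic curves is the proof of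
  **Lemma 6.8** ("Let `α : A → B` be an isogeny of minimal degree; by results of Mazur and Kenku
  we know that `n := deg(α) ≤ 163`") combined with Faltings' Lemma 5
  (`|h(A) − h(B)| ≤ ½ log deg α`). Vendored as `abs_neronLatticeHeight_sub_le_of_isIsogenous`.
* Not vendored (recorded for the consumer): p. 13 (3.2)–(3.4), `h(E) ≤ h(A_{1,N}) + 3 ≤
  ½ log δ_{1,N} + 9` — in the tree this follows from Zagier's PROVED degree formula
  (`ModularParametrizationData.zagier_degree_formula_holds`: `deg · covol(Λ_E) = 4π² c² (f,f)`)
  once the trivial lower bound `log(2π c_f) + log ‖f‖ > −6` (p. 13) is available.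

## Rendering

* `E/ℚ` is `W : WeierstrassCurve ℚ`, elliptic and `IsGloballyMinimal` (so that `IsNeronLatticeOf`
  yields the Néron lattice and `h(E) = neronLatticeHeight L`); `N = W.conductorNorm ℤ`
  (`DiophantineGeometry/Conductor.lean`); "semi-stable away from `S`" = `W.IsSemistableAt v` for
  every finite place `v ∉ S` (`LocalReduction.lean`), `S : Finset (HeightOneSpectrum ℤ)`,
  `P = ∏_{v ∈ S} Nm(v)` (the product of the primes of `S`); `φ = Nat.totient`.
* "`N ≫_{ε,S} 1` (effective)" is rendered as `∃ N₀` depending on `ε, S` (effectivity is not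
  expressible and is dropped — a weakening).
* Isogeny over `ℚ`: the tree's `WeierstrassCurve.IsIsogenous` (`EllipticCurves/Isogeny.lean`).

## References

* H. Pasten, *Shimura curves and the abc conjecture*, J. Number Theory 254 (2024) 214–335,
  arXiv:1705.09251: Thm 1.9 (p. 7), §3 p. 13, Lemma 6.8, Cor. 16.3. [`PastenShimura2024`]
* M. R. Murty, H. Pasten, *Modular forms and effective Diophantine approximation*, J. Number
  Theory 133 (2013) 3739–3754, Thm 1.1 (not read; paywalled). [`MurtyPasten2013`]
* G. Faltings, *Endlichkeitssätze für abelsche Varietäten über Zahlkörpern*, Invent. Math. 73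
  (1983), Lemma 5; B. Mazur, Invent. Math. 44 (1978); M. A. Kenku, J. London Math. Soc. 26 (1982)
  (isogeny degrees over `ℚ`), as cited by Pasten p. 13 and Lemma 6.8.
-/

noncomputable section

open WeierstrassCurve IsDedekindDomain

namespace Literature.NumberTheory.EllipticCurves.ModularForms

/-! ### Pasten 2024, Theorem 1.9 (unconditional branch) -/

/-- **Pasten 2024, Theorem 1.9 (unconditional bound).** For every finite set `S` of rational
primes (finite places of `ℚ`), with `P = ∏_{p ∈ S} p`, and every `ε > 0` there is `N₀ = N₀(ε, S)`
such that for every elliptic curve `E/ℚ` semi-stable away from `S` (good or multiplicative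
reduction at every `v ∉ S`) of conductor `N ≥ N₀`:
`h(E) < (P/φ(P)) · (ε + 1/48) · φ(N) · log N`,
where `h(E) = neronLatticeHeight L` for the Néron lattice `L` of a global minimal model `W` of `E`
and `φ` is Euler's totient. Printed with "`N ≫_{ε,S} 1` (with an effective implicit constant)";
the GRH branch `(P/φ(P))(ε + 1/24) φ(N) log log N` is not vendored. Not proved here (Shimura-curve
parametrisations, Ribet–Takahashi, spectral congruence bounds, §§4–16 of the paper).
[cite: PastenShimura2024, Thm 1.9 (unconditional case)] -/
def pasten2024_height_lt : Prop :=
  ∀ (S : Finset (HeightOneSpectrum ℤ)) (ε : ℝ), 0 < ε → ∃ N₀ : ℕ,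
    ∀ (W : WeierstrassCurve ℚ) [W.IsElliptic] [W.IsGloballyMinimal] (L : PeriodPair),
      IsNeronLatticeOf (W.baseChange ℂ) L →
      (∀ v : HeightOneSpectrum ℤ, v ∉ S → W.IsSemistableAt v) →
      N₀ ≤ W.conductorNorm ℤ →
        neronLatticeHeight L <
          ((∏ v ∈ S, (Ideal.absNorm v.asIdeal : ℝ)) /
              (Nat.totient (∏ v ∈ S, Ideal.absNorm v.asIdeal) : ℝ)) *
            (ε + 1 / 48) * (Nat.totient (W.conductorNorm ℤ) : ℝ) *
            Real.log (W.conductorNorm ℤ)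

/-- **Theorem 1.9 for semistable curves (`S = ∅`)**: "If `S = ∅` then the factor `P/φ(P)` is
`1`": for `ε > 0` and `N ≥ N₀(ε)`, every semistable elliptic curve `E/ℚ` (`W.IsSemistable ℤ`)
has `h(E) < (ε + 1/48) φ(N) log N`. PROVED from `pasten2024_height_lt` with `S = ∅`.
[cite: PastenShimura2024, Thm 1.9 (S = ∅)] -/
theorem pasten2024_height_lt.semistable (h : pasten2024_height_lt) {ε : ℝ} (hε : 0 < ε) :
    ∃ N₀ : ℕ, ∀ (W : WeierstrassCurve ℚ) [W.IsElliptic] [W.IsGloballyMinimal] (L : PeriodPair),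
      IsNeronLatticeOf (W.baseChange ℂ) L → W.IsSemistable ℤ → N₀ ≤ W.conductorNorm ℤ →
        neronLatticeHeight L <
          (ε + 1 / 48) * (Nat.totient (W.conductorNorm ℤ) : ℝ) * Real.log (W.conductorNorm ℤ) := by
  obtain ⟨N₀, hN₀⟩ := h ∅ ε hε
  refine ⟨N₀, fun W _ _ L hL hss hN => ?_⟩
  have := hN₀ W L hL (fun v _ => hss v) hN
  simpa using this

/-- **The crude form `h(E) < (1/48 + ε) N log N`** (Pasten 2024, p. 7, display, for semistable
`E/ℚ` with `N ≫_ε 1`): from `φ(N) ≤ N` and `log N ≥ 0`. PROVED from `pasten2024_height_lt`.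
[cite: PastenShimura2024, §1 p. 7 (display h(E) < (1/48 + ε) N log N)] -/
theorem pasten2024_height_lt.semistable_crude (h : pasten2024_height_lt) {ε : ℝ} (hε : 0 < ε) :
    ∃ N₀ : ℕ, ∀ (W : WeierstrassCurve ℚ) [W.IsElliptic] [W.IsGloballyMinimal] (L : PeriodPair),
      IsNeronLatticeOf (W.baseChange ℂ) L → W.IsSemistable ℤ → N₀ ≤ W.conductorNorm ℤ →
        neronLatticeHeight L <
          (1 / 48 + ε) * (W.conductorNorm ℤ : ℝ) * Real.log (W.conductorNorm ℤ) := by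
  obtain ⟨N₀, hN₀⟩ := h.semistable hε
  refine ⟨max N₀ 1, fun W _ _ L hL hss hN => ?_⟩
  have hN' : N₀ ≤ W.conductorNorm ℤ := le_trans (le_max_left _ _) hN
  have h1 : 1 ≤ W.conductorNorm ℤ := le_trans (le_max_right _ _) hN
  have hlt := hN₀ W L hL hss hN'
  have hlog : 0 ≤ Real.log (W.conductorNorm ℤ) := Real.log_nonneg (by exact_mod_cast h1)
  have htot : (Nat.totient (W.conductorNorm ℤ) : ℝ) ≤ (W.conductorNorm ℤ : ℝ) := by
    exact_mod_cast Nat.totient_le _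
  have hc : 0 ≤ ε + 1 / 48 := by positivity
  calc neronLatticeHeight L
      < (ε + 1 / 48) * (Nat.totient (W.conductorNorm ℤ) : ℝ) * Real.log (W.conductorNorm ℤ) := hlt
    _ ≤ (ε + 1 / 48) * (W.conductorNorm ℤ : ℝ) * Real.log (W.conductorNorm ℤ) := by
        gcongr
    _ = (1 / 48 + ε) * (W.conductorNorm ℤ : ℝ) * Real.log (W.conductorNorm ℤ) := by ring

/-! ### Heights in a `ℚ`-isogeny class: Faltings' Lemma 5 with the Mazur–Kenku bound -/

/-- **`|h(E) − h(E')| ≤ ½ log 163` for `ℚ`-isogenous elliptic curves** (Pasten 2024, §3 p. 13: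
"The degree of a minimal isogeny between `A_{1,N}` and `E` is uniformly bounded by `163` thanks to
Mazur and Kenku, so Lemma 5 in [Faltings] gives `|h(A_{1,N}) − h(E)| ≤ ½ log 163 < 3`"; for an
arbitrary `ℚ`-isogenous pair the same two ingredients are quoted in the proof of Lemma 6.8: "Let
`α : A → B` be an isogeny of minimal degree; by results of Mazur and Kenku we know that
`deg(α) ≤ 163`", and Faltings 1983, Lemma 5: `|h(A) − h(B)| ≤ ½ log deg α`). Rendered with
`h = neronLatticeHeight` of the Néron lattices of global minimal models and the tree's
`WeierstrassCurve.IsIsogenous` (isogeny defined over `ℚ`). Not proved here.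
[cite: PastenShimura2024, §3 p. 13 (|h(A_{1,N}) − h(E)| ≤ ½ log 163) and Lemma 6.8 (proof)] -/
def abs_neronLatticeHeight_sub_le_of_isIsogenous : Prop :=
  ∀ (W W' : WeierstrassCurve ℚ) [W.IsElliptic] [W'.IsElliptic] [W.IsGloballyMinimal]
    [W'.IsGloballyMinimal] (L L' : PeriodPair),
    IsNeronLatticeOf (W.baseChange ℂ) L → IsNeronLatticeOf (W'.baseChange ℂ) L' →
      W.IsIsogenous W' → |neronLatticeHeight L - neronLatticeHeight L'| ≤ Real.log 163 / 2

/-- The printed numerical form `|h(E) − h(E')| < 3` (`½ log 163 = 2.546… < 3`), PROVED from the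
fact. [cite: PastenShimura2024, §3 p. 13 (½ log 163 < 3)] -/
theorem abs_neronLatticeHeight_sub_le_of_isIsogenous.lt_three
    (h : abs_neronLatticeHeight_sub_le_of_isIsogenous) (W W' : WeierstrassCurve ℚ) [W.IsElliptic]
    [W'.IsElliptic] [W.IsGloballyMinimal] [W'.IsGloballyMinimal] (L L' : PeriodPair)
    (hL : IsNeronLatticeOf (W.baseChange ℂ) L) (hL' : IsNeronLatticeOf (W'.baseChange ℂ) L')
    (hiso : W.IsIsogenous W') : |neronLatticeHeight L - neronLatticeHeight L'| < 3 := by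
  have h163 : Real.log 163 / 2 < 3 := by
    have he : (163 : ℝ) < Real.exp 6 := by
      have h1 : (2.7 : ℝ) < Real.exp 1 := lt_trans (by norm_num) Real.exp_one_gt_d9
      have h6 : Real.exp 6 = Real.exp 1 ^ 6 := by rw [← Real.exp_nat_mul]; norm_num
      rw [h6]
      calc (163 : ℝ) < 2.7 ^ 6 := by norm_num
        _ < Real.exp 1 ^ 6 := pow_lt_pow_left₀ h1 (by norm_num) (by norm_num)
    have : Real.log 163 < 6 := by rw [Real.log_lt_iff_lt_exp (by norm_num)]; exact he
    linarith
  exact lt_of_le_of_lt (h W W' L L' hL hL' hiso) h163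

/-! ### Pasten 2024, Lemma 6.8: `c_p` in a `ℚ`-isogeny class -/

/-- **Pasten 2024, Lemma 6.8: `c_p(A)/c_p(B)` has multiplicative height at most `163`** — NAMED
FACT, statement only.  Printed (JNT 254 (2024) = arXiv:1705.09251, §6.4 p. 22): *"Suppose now
that `A` is an elliptic curve over `ℚ` with multiplicative reduction at `p`. Then `Φ_p(A)` is a
cyclic group of order `c_p(A) := v_p(Δ_A)`. Lemma 6.8. Let `A` and `B` be elliptic curves which
are isogenous over `ℚ` and suppose that `p` is a prime of multiplicative reduction for one (hence
both) of them. Then `c_p(A)/c_p(B)` is a rational number whose multiplicative height is at most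
`163`. In particular, it is supported on primes `≤ 163`."*  Proof there: an isogeny `α : A → B`
of minimal degree has `deg α ≤ 163` by Mazur 1978 and Kenku 1982, and the functoriality of the
component groups under `α`, `α^∨` (`α^∨ α = [n]`) shows that numerator and denominator of
`c_p(A)/c_p(B)` divide `n` (also Takahashi 2001, p. 83: "the numerator and denominator … are both
divisors of the minimal degree of the isogeny").  Rendering: `W, W'` elliptic over `ℚ`,
`ℚ`-isogenous (`WeierstrassCurve.IsIsogenous`), `v` a place of `ℤ` at which `W` has
multiplicative reduction (`WeierstrassCurve.HasMultiplicativeReductionAt`), `c_p = ord_p Δ_min`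
(`WeierstrassCurve.ordMinimalDiscriminant v`); conclusion: `c_p(W) · n = c_p(W') · m` for some
`1 ≤ m, n ≤ 163` (the height bound, without insisting on lowest terms).
[cite: PastenShimura2024, Lemma 6.8 (p. 22)] [cite: Mazur1978, Thm. 1] [cite: Kenku1982] -/
def PastenShimura2024_lemma_6_8 : Prop :=
  ∀ (W W' : WeierstrassCurve ℚ) [W.IsElliptic] [W'.IsElliptic], W.IsIsogenous W' →
    ∀ v : HeightOneSpectrum ℤ, W.HasMultiplicativeReductionAt v →
      ∃ m n : ℕ, 0 < m ∧ m ≤ 163 ∧ 0 < n ∧ n ≤ 163 ∧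
        W.ordMinimalDiscriminant v * n = W'.ordMinimalDiscriminant v * m

end Literature.NumberTheory.EllipticCurves.ModularForms

end
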